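import Mathlib
import Literature.Analysis.FluidPDE.SelfSimilar
import Literature.Analysis.FluidPDE.TypeIAncientMild
import Literature.Analysis.FluidPDE.VorticityDoubleConeRegularity
import Literature.Analysis.FluidPDE.VorticityDoubleConeSelfSimilar
import Summits.NavierStokesRegularity.NavierStokesRegularity.Theorems.QuantisedSymmetryPolyhedralDssProfileExistsStubAncientMildOfClassicalTypeI
import Summits.NavierStokesRegularity.NavierStokesRegularity.Theorems.DssFarFieldSlavingBlowupTypeIDssProfileSmoothRepresentativeAe
import Summits.NavierStokesRegularity.NavierStokesRegularity.Theorems.DssFarFieldSlavingBlowupTypeIDssProfileControlsClassLevel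
import Summits.NavierStokesRegularity.NavierStokesRegularity.Theorems.DssFarFieldSlavingBlowupTypeIDssProfileTiltedIsotropy
import HarnessLib

/-!
# Cell E23 at CLASS level — vorticity directions in a closed double cone (FACT-CONDITIONAL)
  (route `DssFarFieldSlaving`, crux `BlowupTypeIDssProfile`, stmt-NavierStokesRegularity-0155 — SUPPORT;
  cell pub-ns-dss theory seat g4, EMPTY-CELLS row E23; the Literature side is lit's
  `VorticityDoubleConeSelfSimilar.lean`)

HONEST FRAMING. CONDITIONAL on the unproved, unrefereed fact `LeiRenTian2025_doubleCone_regularity`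
(Lei–Ren–Tian 2025, Thm 1.1, hypothesis `hLRT`) AND on local suitability of the representative, which is
ASSUMED, not derived from membership. Level (lead A22): class + Literature-fact hypothesis. An empty cell
is a solver control, never a statement about Navier–Stokes regularity.

`rdssClass_doubleCone_empty`: no member `u` of the hypothesis class of
`Theses.FilamentSkeletonRss.RdssProfileTruncation` (H0 `1 < c`, H5 ancient mild, H4 measurable slices,
H2 `(c, R)`-RDSS, H3 Type-I bound `M`, H6 non-trivial) has an Oseen-gauge representative `V`
(`IsTypeIAncientMild M V`, `V t =ᵐ u t`; it exists and is unique by `typeI_ancient_smoothRepresentative_ae`)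
that is a local suitable weak solution in `Q(1)` whose vorticity direction lies in a closed double cone
about some axis wherever the vorticity exceeds a threshold (at regular points of `Q(1)`). Route: T2 bridge
→ `V` continuous and slice-differentiable on the past, `(c, R)`-RDSS pointwise
(`ControlsClassLevel.isRotatedDSS_of_ae_structure`) → lit's corollary
`LeiRenTian2025_doubleCone_regularity.rdss_eq_zero` (LRT Thm 1.1 ⇒ origin regular ⇒ bounded on a
backward cylinder ⇒ RDSS field vanishes, Chae–Wolf 2017 §3 step 1) → `u t =ᵐ 0`, contradicting H6.
-/

noncomputable section

set_option linter.dupNamespace false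

namespace Summit.NavierStokesRegularity.NavierStokesRegularity.Theorems.DoubleCone

open MeasureTheory Set Function Literature.Analysis.FluidPDE
open Summit.NavierStokesRegularity.NavierStokesRegularity.Theorems
open Summit.NavierStokesRegularity.NavierStokesRegularity.Theorems.TiltedIsotropy

/-- The open past `{t < 0}` as the slab `(-∞, 0) × ℝ³`. [folklore] -/
private theorem setOf_fst_lt_eq :
    {z : ℝ × EuclideanSpace ℝ (Fin 3) | z.1 < 0} = Iio (0 : ℝ) ×ˢ (univ : Set (EuclideanSpace ℝ (Fin 3))) := by
  ext z
  simp

/-- **Cell E23 is EMPTY at class level, conditionally on Lei–Ren–Tian 2025 Thm 1.1** (`hLRT`) and on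
local suitability of the representative (inside `hcell`). For every Type-I bound `M`: no member of the
class whose Oseen-gauge representative `V` is `Q(1)`-suitable with vorticity directions in a closed double
cone `{|ξ × e| ≤ 1 - δ}` wherever `|ω| > M₀` at regular points of `Q(1)`. [cite: LeiRenTian2025, Thm. 1.1 (arXiv:2501.08976, p. 4) — class-level corollary, conditional]
[cite: ChaeWolf2017RemovingDSS, §3 step 1 (arXiv:1610.09464 p. 8)] -/
theorem rdssClass_doubleCone_empty (hLRT : LeiRenTian2025_doubleCone_regularity) (M : ℝ) :
    ¬ ∃ (c : ℝ) (R : EuclideanSpace ℝ (Fin 3) ≃ₗᵢ[ℝ] EuclideanSpace ℝ (Fin 3))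
        (u : ℝ → EuclideanSpace ℝ (Fin 3) → EuclideanSpace ℝ (Fin 3)),
      1 < c ∧ IsAncientMildSolution 1 u ∧ (∀ t < 0, AEStronglyMeasurable (u t) volume) ∧
      IsRotatedDSS c R u ∧ HasTypeIDecay M u ∧
      (∀ V : ℝ → EuclideanSpace ℝ (Fin 3) → EuclideanSpace ℝ (Fin 3),
        IsTypeIAncientMild M V → (∀ t < 0, V t =ᵐ[volume] u t) → (∀ t, 0 ≤ t → ∀ x, V t x = 0) →
        ∃ (p : ℝ → EuclideanSpace ℝ (Fin 3) → ℝ) (e : EuclideanSpace ℝ (Fin 3)) (δ M₀ : ℝ),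
          IsSuitableWeakSolutionInBall 1 0 V p ∧ ‖e‖ = 1 ∧ 0 < δ ∧ 0 < M₀ ∧
          ∀ z ∈ parabolicCylinder 1 (0 : ℝ × EuclideanSpace ℝ (Fin 3)),
            ¬ IsBackwardSingularPoint V z →
            ‖curl (V z.1) z.2‖ ≤ M₀ ∨
              ‖cross (vorticityDirection (curl (V z.1)) z.2) e‖ ≤ 1 - δ) ∧
      ¬ (∀ t < 0, u t =ᵐ[volume] 0) := by
  rintro ⟨c, R, u, hc, hmild, hmeas, hdss, hTI, hcell, hne⟩
  obtain ⟨V, hT, -, hVu, hV0⟩ := typeI_ancient_smoothRepresentative_ae hmild hmeas hTI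
  obtain ⟨p, e, δ, M₀, hsw, he, hδ, hM₀, hcone⟩ := hcell V hT hVu hV0
  have hVc : ∀ t < 0, Continuous (V t) := fun t ht => slice_continuous hT ht
  have hdssV : IsRotatedDSS c R V :=
    ControlsClassLevel.isRotatedDSS_of_ae_structure (zero_lt_one.trans hc)
      (fun t _ => Filter.EventuallyEq.of_eq (funext fun x => hdss t x)) hVc hVu hV0
  have hcont : ContinuousOn (uncurry V) {z : ℝ × EuclideanSpace ℝ (Fin 3) | z.1 < 0} := by
    rw [setOf_fst_lt_eq]
    exact hT.1.continuousOn
  have hdiff : ∀ t < 0, Differentiable ℝ (V t) := fun t ht => slice_differentiable hT ht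
  have hz : ∀ t < 0, ∀ x, V t x = 0 := hLRT.rdss_eq_zero hc hdssV hsw hcont hdiff he hδ hM₀ hcone
  exact hne fun t ht =>
    (hVu t ht).symm.trans (Filter.EventuallyEq.of_eq (funext fun x => hz t ht x))

end Summit.NavierStokesRegularity.NavierStokesRegularity.Theorems.DoubleCone

end
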